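import Summits.PneNP.PneNP.Theorems.OverlapGapAlgebraNoStableSectionGlue0

/-!
# Crux `NoStableSection` (stmt-PneNP-2462), line `DartGame` — glue 1: the two first moments

Union bounds reducing `#IndepBad` (over `ℓ ≤ k`, `t₀ ≤ T`, `ts : Fin ℓ → [0,T]`, then the stubs
`IndepCount` with the candidate count of `CondEntCount`) and `#OgpBad` (over time tuples and
admissible ladders, then `PathValidCount` with an energy lower bound and the tuple count of
`CondEntCount`). Registered sub-goal `stub_glueUnionBound`. Lead prover-line-stmt-PneNP-2462-0.
-/

namespace Summit.PneNP.PneNP.Cruxes.NoStableSection.DartGame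

set_option linter.dupNamespace false -- `Summit.PneNP.PneNP.…`: summit = sub-problem (D-0017)

open Finset Real

/-! ## Glue, part 2: union bounds (first moments) -/

section Counting

open Finset
open scoped Classical

variable {k m n : ℕ}

/-- Union bound over a finite index type. -/
theorem glue_card_filter_exists_le {α ι : Type*} [Fintype α] [Fintype ι] (P : ι → α → Prop)
    [∀ i, DecidablePred (P i)] [DecidablePred fun a => ∃ i, P i a] :
    ((univ.filter fun a => ∃ i, P i a).card : ℝ) ≤ ∑ i, ((univ.filter (P i)).card : ℝ) := by
  classical
  have hsub : (univ.filter fun a => ∃ i, P i a) ⊆ univ.biUnion fun i => univ.filter (P i) := by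
    intro a ha
    simp only [mem_filter, mem_univ, true_and, mem_biUnion] at ha ⊢
    exact ha
  calc ((univ.filter fun a => ∃ i, P i a).card : ℝ)
      ≤ ((univ.biUnion fun i => univ.filter (P i)).card : ℝ) := by exact_mod_cast card_le_card hsub
    _ ≤ ∑ i, ((univ.filter (P i)).card : ℝ) := by exact_mod_cast card_biUnion_le

/-- Monotonicity of a filtered count under implication. -/
theorem glue_card_filter_mono {α : Type*} [Fintype α] {P Q : α → Prop} [DecidablePred P]
    [DecidablePred Q] (h : ∀ a, P a → Q a) :
    ((univ.filter P).card : ℝ) ≤ ((univ.filter Q).card : ℝ) := by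
  exact_mod_cast card_le_card fun a ha => by
    simp only [mem_filter, mem_univ, true_and] at ha ⊢; exact h a ha

/-- `violCount ≤ ν m` as an integer bound `≤ ⌊ν m⌋₊`. -/
theorem glue_viol_le_floor {ν : ℝ} {v m' : ℕ} (_hν : 0 ≤ ν) (h : (v : ℝ) ≤ ν * m') :
    v ≤ ⌊ν * (m' : ℝ)⌋₊ :=
  Nat.le_floor h

/-- **First moment for `S_indep`** (union over `ℓ ≤ k`, `t₀ ≤ T`, `ts : Fin ℓ → [0,T]`, then Stub F
with the candidate count of Stub C as `Bc`). -/
theorem glue_card_indepBad_le (hC : CondEntCount) (hF : IndepCount) (hn : 1 ≤ n)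
    (g : Inst m k n → Fin n → Bool) {ν bp : ℝ} (hν : 0 ≤ ν) :
    ((univ.filter fun Ψ : PathSp k m n => IndepBad g ν bp Ψ).card : ℝ) ≤
      ((k : ℝ) + 1) * ((k * (m * k) : ℕ) + 1 : ℝ) ^ (k + 1) *
        ((((n : ℝ) + 1) ^ (2 ^ k) * Real.exp (n * bp)) *
          (∑ j ∈ range (⌊ν * (m : ℝ)⌋₊ + 1), (m.choose j : ℝ)) *
          (1 - (1 / 2 : ℝ) ^ k) ^ (m - ⌊ν * (m : ℝ)⌋₊) * Fintype.card (PathSp k m n)) := by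
  classical
  set T : ℕ := k * (m * k) with hT
  set J : ℕ := ⌊ν * (m : ℝ)⌋₊ with hJ
  set Bc : ℝ := ((n : ℝ) + 1) ^ (2 ^ k) * Real.exp (n * bp) with hBc
  set B : ℝ := Bc * (∑ j ∈ range (J + 1), (m.choose j : ℝ)) *
    (1 - (1 / 2 : ℝ) ^ k) ^ (m - J) * Fintype.card (PathSp k m n) with hB
  -- the parametrised pieces
  set Q : (ℓ : Fin (k + 1)) → Fin (T + 1) → (Fin ℓ → Fin (T + 1)) → PathSp k m n → Prop :=
    fun ℓ t₀ ts Ψ => (∀ j, (ts j : ℕ) + m * k ≤ t₀) ∧ ∃ y : Fin n → Bool,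
      violCount y (instAt Ψ t₀) ≤ J ∧
      condEnt (withRung (seqOf fun j : Fin ℓ => g (instAt Ψ (ts j))) ℓ y) ℓ ≤ bp with hQ
  have hB0 : 0 ≤ B := by
    have : (0 : ℝ) ≤ 1 - (1 / 2 : ℝ) ^ k := by
      have : (1 / 2 : ℝ) ^ k ≤ 1 := pow_le_one₀ (by norm_num) (by norm_num)
      linarith
    positivity
  -- each piece is bounded by `B`
  have hpiece : ∀ (ℓ : Fin (k + 1)) (t₀ : Fin (T + 1)) (ts : Fin ℓ → Fin (T + 1)),
      ((univ.filter (Q ℓ t₀ ts)).card : ℝ) ≤ B := by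
    intro ℓ t₀ ts
    by_cases hadm : ∀ j, (ts j : ℕ) + m * k ≤ t₀
    · have hBc' : ∀ R : ℕ → Fin n → Bool,
          ((univ.filter fun y : Fin n → Bool => condEnt (withRung R ℓ y) ℓ ≤ bp).card : ℝ) ≤ Bc := by
        intro R
        refine (hC.1 n ℓ R bp).trans ?_
        refine mul_le_mul_of_nonneg_right ?_ (Real.exp_nonneg _)
        exact pow_le_pow_right₀ (by linarith) (Nat.pow_le_pow_right (by norm_num)
          (Nat.lt_succ_iff.1 ℓ.isLt))
      have h := hF k m n g ℓ t₀ (fun j => ts j) J bp Bc hn (Nat.lt_succ_iff.1 t₀.isLt) hadm hBc'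
      refine le_trans (glue_card_filter_mono fun Ψ hΨ => hΨ.2) h
    · have : univ.filter (Q ℓ t₀ ts) = ∅ := by
        refine filter_eq_empty_iff.2 fun Ψ _ hΨ => hadm hΨ.1
      rw [this, card_empty, Nat.cast_zero]
      exact hB0
  -- the event is covered by the pieces
  have hcover : ∀ Ψ : PathSp k m n, IndepBad g ν bp Ψ →
      ∃ ℓ : Fin (k + 1), ∃ t₀ : Fin (T + 1), ∃ ts : Fin ℓ → Fin (T + 1), Q ℓ t₀ ts Ψ := by
    rintro Ψ ⟨ℓ, t₀, ts, y, ht₀, hts, hviol, hent⟩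
    refine ⟨ℓ, ⟨t₀, Nat.lt_succ_of_le ht₀⟩,
      fun j => ⟨ts j, Nat.lt_succ_of_le ((Nat.le_add_right _ _).trans ((hts j).trans ht₀))⟩,
      fun j => hts j, y, glue_viol_le_floor hν hviol, hent⟩
  calc ((univ.filter fun Ψ : PathSp k m n => IndepBad g ν bp Ψ).card : ℝ)
      ≤ ((univ.filter fun Ψ => ∃ ℓ : Fin (k + 1), ∃ t₀ : Fin (T + 1),
          ∃ ts : Fin ℓ → Fin (T + 1), Q ℓ t₀ ts Ψ).card : ℝ) := glue_card_filter_mono hcover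
    _ ≤ ∑ ℓ : Fin (k + 1), ((univ.filter fun Ψ => ∃ t₀ : Fin (T + 1),
          ∃ ts : Fin ℓ → Fin (T + 1), Q ℓ t₀ ts Ψ).card : ℝ) := glue_card_filter_exists_le _
    _ ≤ ∑ ℓ : Fin (k + 1), ∑ t₀ : Fin (T + 1), ((univ.filter fun Ψ =>
          ∃ ts : Fin ℓ → Fin (T + 1), Q ℓ t₀ ts Ψ).card : ℝ) :=
        sum_le_sum fun ℓ _ => glue_card_filter_exists_le _
    _ ≤ ∑ ℓ : Fin (k + 1), ∑ t₀ : Fin (T + 1), ∑ ts : Fin ℓ → Fin (T + 1),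
          ((univ.filter (Q ℓ t₀ ts)).card : ℝ) :=
        sum_le_sum fun ℓ _ => sum_le_sum fun t₀ _ => glue_card_filter_exists_le _
    _ ≤ ∑ ℓ : Fin (k + 1), ∑ t₀ : Fin (T + 1), ∑ ts : Fin ℓ → Fin (T + 1), B :=
        sum_le_sum fun ℓ _ => sum_le_sum fun t₀ _ => sum_le_sum fun ts _ => hpiece ℓ t₀ ts
    _ = ∑ ℓ : Fin (k + 1), ((T : ℝ) + 1) * (((T : ℝ) + 1) ^ (ℓ : ℕ) * B) := by
        refine sum_congr rfl fun ℓ _ => ?_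
        simp only [sum_const, card_univ, Fintype.card_fin, Fintype.card_fun, nsmul_eq_mul]
        push_cast
        ring
    _ ≤ ∑ ℓ : Fin (k + 1), ((T : ℝ) + 1) * (((T : ℝ) + 1) ^ k * B) := by
        refine sum_le_sum fun ℓ _ => mul_le_mul_of_nonneg_left
          (mul_le_mul_of_nonneg_right (pow_le_pow_right₀ (by linarith) (Nat.lt_succ_iff.1 ℓ.isLt))
            hB0) (by positivity)
    _ = ((k : ℝ) + 1) * ((T : ℝ) + 1) ^ (k + 1) * B := by
        simp only [sum_const, card_univ, Fintype.card_fin, nsmul_eq_mul]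
        push_cast
        ring

/-- **First moment for `S_ogp`** (union over time tuples and admissible ladders, then Stub E with
the energy bound `D` supplied for every admissible ladder, and the tuple count of Stub C). -/
theorem glue_card_ogpBad_le (hC : CondEntCount) (hE : PathValidCount) (hn : 1 ≤ n)
    {ν bm bp D : ℝ} (hν : 0 ≤ ν) (hbp : 0 ≤ bp) (_hD : 0 ≤ D)
    (hslots : 0 ≤ (m : ℝ) - (k + 1) * ⌊ν * (m : ℝ)⌋₊ - (k + 1))
    (hDY : ∀ Y : Fin (k + 1) → Fin n → Bool,
      (∀ ℓ : Fin (k + 1), 1 ≤ (ℓ : ℕ) → condEnt (seqOf Y) ℓ ∈ Set.Icc bm bp) →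
      D ≤ (energySum (seqOf Y) k : ℝ) / (n : ℝ) ^ k) :
    ((univ.filter fun Ψ : PathSp k m n => OgpBad k m n ν bm bp Ψ).card : ℝ) ≤
      ((k * (m * k) : ℕ) + 1 : ℝ) ^ (k + 1) *
        ((2 : ℝ) ^ n * (((n : ℝ) + 1) ^ (2 ^ k) * Real.exp (n * bp)) ^ k) *
        ((∑ j ∈ range ((k + 1) * ⌊ν * (m : ℝ)⌋₊ + 1), (m.choose j : ℝ)) *
          Real.exp (-((1 / 2 : ℝ) ^ k * D * ((m : ℝ) - (k + 1) * ⌊ν * (m : ℝ)⌋₊ - (k + 1)))) *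
          Fintype.card (PathSp k m n)) := by
  classical
  set T : ℕ := k * (m * k) with hT
  set J : ℕ := ⌊ν * (m : ℝ)⌋₊ with hJ
  set U : ℝ := (∑ j ∈ range ((k + 1) * J + 1), (m.choose j : ℝ)) *
    Real.exp (-((1 / 2 : ℝ) ^ k * D * ((m : ℝ) - (k + 1) * J - (k + 1)))) *
    Fintype.card (PathSp k m n) with hU
  set Adm : Finset (Fin (k + 1) → Fin n → Bool) := univ.filter fun Y =>
    ∀ ℓ : Fin (k + 1), 1 ≤ (ℓ : ℕ) → condEnt (seqOf Y) ℓ ∈ Set.Icc bm bp with hAdm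
  set R : (Fin (k + 1) → Fin (T + 1)) → (Fin (k + 1) → Fin n → Bool) → PathSp k m n → Prop :=
    fun ts Y Ψ => Y ∈ Adm ∧ ∀ ℓ, violCount (Y ℓ) (instAt Ψ (ts ℓ)) ≤ J with hR
  have hU0 : 0 ≤ U := by positivity
  -- each piece
  have hpiece : ∀ (ts : Fin (k + 1) → Fin (T + 1)) (Y : Fin (k + 1) → Fin n → Bool),
      ((univ.filter (R ts Y)).card : ℝ) ≤ (if Y ∈ Adm then U else 0) := by
    intro ts Y
    by_cases hY : Y ∈ Adm
    · rw [if_pos hY]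
      have hts : ∀ ℓ, ((ts ℓ : ℕ)) ≤ k * (m * k) := fun ℓ => Nat.lt_succ_iff.1 (ts ℓ).isLt
      have h := hE k m n (fun ℓ => ts ℓ) Y J hn hts
      refine le_trans (glue_card_filter_mono fun Ψ hΨ => hΨ.2) (h.trans ?_)
      refine mul_le_mul_of_nonneg_right (mul_le_mul_of_nonneg_left ?_ (by positivity))
        (by positivity)
      refine Real.exp_le_exp.2 (neg_le_neg ?_)
      have hY' : ∀ ℓ : Fin (k + 1), 1 ≤ (ℓ : ℕ) → condEnt (seqOf Y) ℓ ∈ Set.Icc bm bp := by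
        simpa [hAdm] using hY
      have := hDY Y hY'
      nlinarith [pow_nonneg (show (0:ℝ) ≤ 1 / 2 by norm_num) k, hslots, this,
        mul_nonneg (pow_nonneg (show (0:ℝ) ≤ 1 / 2 by norm_num) k) hslots]
    · rw [if_neg hY]
      have : univ.filter (R ts Y) = ∅ := filter_eq_empty_iff.2 fun Ψ _ hΨ => hY hΨ.1
      rw [this, card_empty, Nat.cast_zero]
  -- cover
  have hcover : ∀ Ψ : PathSp k m n, OgpBad k m n ν bm bp Ψ →
      ∃ ts : Fin (k + 1) → Fin (T + 1), ∃ Y : Fin (k + 1) → Fin n → Bool, R ts Y Ψ := by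
    rintro Ψ ⟨ts, Y, hmono, hlast, hviol, hent⟩
    refine ⟨fun ℓ => ⟨ts ℓ, Nat.lt_succ_of_le ((hmono (Fin.le_last ℓ)).trans hlast)⟩, Y, ?_, ?_⟩
    · simpa [hAdm] using hent
    · intro ℓ
      exact glue_viol_le_floor hν (hviol ℓ)
  -- the admissible ladders
  have hAdmCard : (Adm.card : ℝ) ≤ (2 : ℝ) ^ n * (((n : ℝ) + 1) ^ (2 ^ k) * Real.exp (n * bp)) ^ k := by
    refine le_trans ?_ (hC.2 n k bp hbp)
    exact_mod_cast card_le_card fun Y hY => by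
      simp only [hAdm, mem_filter, mem_univ, true_and] at hY ⊢
      exact fun ℓ hℓ => (hY ℓ hℓ).2
  calc ((univ.filter fun Ψ : PathSp k m n => OgpBad k m n ν bm bp Ψ).card : ℝ)
      ≤ ((univ.filter fun Ψ => ∃ ts : Fin (k + 1) → Fin (T + 1),
          ∃ Y : Fin (k + 1) → Fin n → Bool, R ts Y Ψ).card : ℝ) := glue_card_filter_mono hcover
    _ ≤ ∑ ts : Fin (k + 1) → Fin (T + 1), ((univ.filter fun Ψ =>
          ∃ Y : Fin (k + 1) → Fin n → Bool, R ts Y Ψ).card : ℝ) := glue_card_filter_exists_le _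
    _ ≤ ∑ ts : Fin (k + 1) → Fin (T + 1), ∑ Y : Fin (k + 1) → Fin n → Bool,
          ((univ.filter (R ts Y)).card : ℝ) :=
        sum_le_sum fun ts _ => glue_card_filter_exists_le _
    _ ≤ ∑ ts : Fin (k + 1) → Fin (T + 1), ∑ Y : Fin (k + 1) → Fin n → Bool,
          (if Y ∈ Adm then U else 0) :=
        sum_le_sum fun ts _ => sum_le_sum fun Y _ => hpiece ts Y
    _ = ∑ ts : Fin (k + 1) → Fin (T + 1), (Adm.card : ℝ) * U := by
        refine sum_congr rfl fun ts _ => ?_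
        rw [← sum_filter, sum_const, nsmul_eq_mul]
        congr 2
        simp [hAdm]
    _ = ((T : ℝ) + 1) ^ (k + 1) * ((Adm.card : ℝ) * U) := by
        simp only [sum_const, card_univ, Fintype.card_fun, Fintype.card_fin, nsmul_eq_mul]
        push_cast
        ring
    _ ≤ ((T : ℝ) + 1) ^ (k + 1) *
          (((2 : ℝ) ^ n * (((n : ℝ) + 1) ^ (2 ^ k) * Real.exp (n * bp)) ^ k) * U) := by
        gcongr
    _ = ((k * (m * k) : ℕ) + 1 : ℝ) ^ (k + 1) *
        ((2 : ℝ) ^ n * (((n : ℝ) + 1) ^ (2 ^ k) * Real.exp (n * bp)) ^ k) *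
        ((∑ j ∈ range ((k + 1) * J + 1), (m.choose j : ℝ)) *
          Real.exp (-((1 / 2 : ℝ) ^ k * D * ((m : ℝ) - (k + 1) * J - (k + 1)))) *
          Fintype.card (PathSp k m n)) := by
        rw [hU, hT]; push_cast; ring

end Counting

/-! ## Registered sub-goal of this file -/

/-- **Sub-goal `stub_glueUnionBound`** (registered on stmt-PneNP-2462): the finite union bound
behind both first moments. -/
theorem stub_glueUnionBound : ∀ {α ι : Type} [Fintype α] [Fintype ι] (P : ι → α → Prop) [∀ i, DecidablePred (P i)] [DecidablePred fun a => ∃ i, P i a], ((Finset.univ.filter fun a => ∃ i, P i a).card : ℝ) ≤ ∑ i, ((Finset.univ.filter (P i)).card : ℝ) :=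
  by
  intro α ι _ _ P _ _
  exact glue_card_filter_exists_le P

end Summit.PneNP.PneNP.Cruxes.NoStableSection.DartGame
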